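import Summits.BirchSwinnertonDyer.Rank1Residual.X11b.RouteR1HalvesAllFrames
import Summits.BirchSwinnertonDyer.Rank1Residual.X11b.RouteR1IMCEqIntCoreFrame
import Summits.BirchSwinnertonDyer.Rank1Residual.X11b.UnrSeriesIdealDescent
import HarnessLib

/-!
# X11b, route R1 at `p ≥ 5` — the main-conjecture EQUALITY does not see the receptacle: H3 over
# `R₀⟦T⟧` ⟺ H3♭ over `𝓞_{ℂ_p}⟦T⟧` for the same `L` (every `p`), and on semistable pairs ALL of route
# R1's H3 currencies (∀-frame with `Ω_K ≠ 0`, ∃-frame, ∃-core, ∃♭-core) are EQUIVALENT given A206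

HONEST FRAMING (cell `b2b-bsdres`, run/shared/lean/b2b/bsd-rank1-residual/, verbatim in every
file): the goal of the cell is to DELETE the COMBINATION-SHAPED residual classes of the
Birch–Swinnerton-Dyer formula for ALL analytic-rank `≤ 1` elliptic curves over `ℚ` — "full BSD
formula for every rank `≤ 1` curve in class `C`" assembled STRICTLY from published theorems — so
that the rank-`≤ 1` remainder becomes exactly the CONSTRUCTION-SHAPED classes, which are TYPED
(missing-input `Prop`s), NOT attempted. This is not "finishing BSD". Sub-cell
`b2b-bsdres-multr1-p1` (X11b, route R1, gen 26); a RESEARCH ROUTE; no claim beyond the stated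
class; X11b stays CONSTRUCTION-SHAPED; nothing here changes a label; THEOREMS ONLY; no definition,
no named fact, no `sorry`; every result mentioning an OPEN shape is an implication between OPEN
shapes (nothing asserted).

## What this file does

Gen 23 read route R1's H3 (`R1.IMCEqOnTreeAt W p κ 𝔭 γ L`: `Ch_Λ(X_ac^∅)·R₀⟦T⟧ = (L)`) in the wide
receptacle (`R1.IMCEqIntAt W p κ 𝔭 γ Q`: `Ch_Λ(X_ac^∅)·𝓞_{ℂ_p}⟦T⟧ = (Q)`), with the trivial direction
`R1.imcEqIntAt_map` (H3 ⟹ H3♭ for `Q = L` read in `𝓞_{ℂ_p}⟦T⟧`). multr1-p2 GEN 26 proved that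
`R₀⟦T⟧ → 𝓞_{ℂ_p}⟦T⟧` REFLECTS membership in principal ideals (`unrSeries_mem_span_singleton_of_map_mem`,
`ideal_map_toUnr_le_span_of_map_toCpInt_le`, `X11b/UnrSeriesIdealDescent.lean`). With the tree
theorem that `Ch_Λ` of ANY `Λ`-module is principal (`charIdeal_isPrincipal_holds`: `Λ` is a UFD) the
EQUALITY descends too:

* §1 **`R1.imcEqOnTreeAt_of_imcEqIntAt_map`** / **`R1.imcEqOnTreeAt_iff_imcEqIntAt_map`** (every
  `p`, no hypothesis): `Ch·R₀⟦T⟧ = (L)` iff `Ch·𝓞_{ℂ_p}⟦T⟧ = (L)`.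
* §2 **`R1.imcEqAllFramesOnTree_of_imcEqIntCoreFrame`** — H3∃♭⁻ (`R1.IMCEqIntCoreFrameOnTree`, gen 25:
  per datum ONE ♭-frame `(Ω_K ≠ 0, ‖Ω_p‖ = 1, Q)` with the ♭-interpolation property and H3♭) ⟹ H3∀′
  (`R1.IMCEqAllFramesOnTree`, gen 26: H3 at EVERY `R₀`-frame with `Ω_K ≠ 0`), NO fact, NO
  semistability: ♭-IDEAL RIGIDITY (`R1.imcEqIntAt_forall_of_exists`, gen 25) moves H3♭ from `Q` to
  the `R₀`-frame read in `𝓞_{ℂ_p}⟦T⟧` (`R1.isBDPLFunctionInt_map`), and §1 descends it.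
  **`R1.imcEqCoreFrameOnTree_of_imcEqIntCoreFrame_of_bdpExists`** — on a SEMISTABLE pair, given A206
  (an `R₀`-frame EXISTS), H3∃♭⁻ ⟹ H3∃⁻; hence the square of equivalences
  **`R1.imcEqCoreFrameOnTree_iff_imcEqIntCoreFrame`**, **`R1.imcEqAllFramesOnTree_iff_imcEqIntCoreFrame`**
  (with gen 26's `R1.imcEqAllFramesOnTree_iff_imcEqCoreFrame`): on semistable pairs, given A206,
  H3∀′ ⟺ H3∃⁻ ⟺ H3∃♭⁻ — route R1's main-conjecture half is ONE statement per datum, independent of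
  the frame AND of the receptacle (`R₀⟦T⟧` or `𝓞_{ℂ_p}⟦T⟧`), so a refereed main conjecture typed in
  EITHER normalisation / receptacle instantiates every R1 record.

CONDITIONAL where said (implications between OPEN shapes); deletes nothing; X11b stays
CONSTRUCTION-SHAPED; no label change; wording of record unchanged.

References: [Castella2018] §2.2, Thm. 3.1, §3 (arXiv:1704.06608 pp. 5, 9); [Castella2018Erratum]
Thm. 1.1 (p. 1); [Hsieh2014] Thm. 1 (the receptacle `𝓞_{ℂ_p}⟦T⟧`); [Washington1997] §13.2.
-/

noncomputable section

open scoped Classical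

open WeierstrassCurve NumberField IsDedekindDomain Field PowerSeries
open Literature.NumberTheory.EllipticCurves Literature.NumberTheory.EllipticCurves.GreenbergSelmer
open Literature.NumberTheory.EllipticCurves.ModularForms
open Literature.NumberTheory.EllipticCurves.Rank1Residual
open Literature.NumberTheory.EllipticCurves.Rank1Residual.Typed
open Literature.NumberTheory.EllipticCurves.Castella2018
open Literature.NumberTheory.GaloisRepresentations
open Literature.NumberTheory.GaloisCohomology
open Summit.BirchSwinnertonDyer.Rank1Residual.X11b.AcSelmer
open Summit.BirchSwinnertonDyer.Rank1Residual.X11b.Halves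

namespace Summit.BirchSwinnertonDyer.Rank1Residual.X11b

/-! ### §1 H3 over `R₀⟦T⟧` iff H3♭ over `𝓞_{ℂ_p}⟦T⟧`, for the same `L` (every `p`) -/

section Pointwise

variable {K : Type} [Field K] [NumberField K] {W : WeierstrassCurve ℚ} {p : ℕ} [Fact p.Prime]
  {κ : ZpExtension K p} {𝔭 : HeightOneSpectrum (𝓞 K)} {γ : Field.absoluteGaloisGroup K}
  [Fact (κ.IsTopGenerator γ)]

/-- **H3♭ for `L` read in `𝓞_{ℂ_p}⟦T⟧` ⟹ H3 for `L` over `R₀⟦T⟧`** (every `p`, no hypothesis): if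
`Ch_Λ(X_ac^∅)·𝓞_{ℂ_p}⟦T⟧ = (L)` then `Ch_Λ(X_ac^∅)·R₀⟦T⟧ = (L)`. The inclusion `⊆` descends by
multr1-p2's `ideal_map_toUnr_le_span_of_map_toCpInt_le`; for `⊇`, `Ch_Λ = (f)` is principal
(`charIdeal_isPrincipal_holds`: `Λ` is a UFD) and `L ∈ (f)·𝓞_{ℂ_p}⟦T⟧` descends to `L ∈ (f)·R₀⟦T⟧` by
`unrSeries_mem_span_singleton_of_map_mem`. [cite: Castella2018, §3 (arXiv:1704.06608 p. 9) (the receptacle `Λ_{R₀}`)]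
[cite: Washington1997, §13.2 (characteristic ideals are principal)] -/
theorem R1.imcEqOnTreeAt_of_imcEqIntAt_map {L : UnrSeries p}
    (h : R1.IMCEqIntAt W p κ 𝔭 γ (PowerSeries.map (R1.unrToCpInt p) L)) :
    R1.IMCEqOnTreeAt W p κ 𝔭 γ L := by
  unfold R1.IMCEqOnTreeAt
  unfold R1.IMCEqIntAt at h
  apply le_antisymm (ideal_map_toUnr_le_span_of_map_toCpInt_le _ L h.le)
  -- `Ch = (f)` is principal; `L ∈ (f)` in `𝓞_{ℂ_p}⟦T⟧` descends to `R₀⟦T⟧`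
  obtain ⟨f, hf⟩ := (Literature.NumberTheory.EllipticCurves.charIdeal_isPrincipal_holds p
    (XAc (W.baseChange K) p κ 𝔭 ∅ γ)).principal
  have hf' : XAc.charIdeal (W.baseChange K) p κ 𝔭 ∅ γ = Ideal.span {f} := hf
  have hge : Ideal.span {PowerSeries.map (R1.unrToCpInt p) L} ≤
      (XAc.charIdeal (W.baseChange K) p κ 𝔭 ∅ γ).map (PowerSeries.map (R1.toCpInt p)) := h.ge
  rw [hf', Ideal.map_span, Set.image_singleton, Ideal.span_singleton_le_iff_mem] at hge ⊢
  apply unrSeries_mem_span_singleton_of_map_mem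
  rw [R1.map_unrToCpInt_map_toUnr]
  exact hge

/-- **H3 does not see the receptacle** (every `p`): `Ch_Λ(X_ac^∅)·R₀⟦T⟧ = (L)` iff
`Ch_Λ(X_ac^∅)·𝓞_{ℂ_p}⟦T⟧ = (L)` for `L ∈ R₀⟦T⟧` read in `𝓞_{ℂ_p}⟦T⟧`. [cite: Castella2018Erratum, Thm. 1.1 (p. 1)]
[cite: Hsieh2014, Thm. 1 (arXiv:1112.1580) (the receptacle `𝓞_{ℂ_p}⟦T⟧`)] -/
theorem R1.imcEqOnTreeAt_iff_imcEqIntAt_map {L : UnrSeries p} :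
    R1.IMCEqOnTreeAt W p κ 𝔭 γ L ↔ R1.IMCEqIntAt W p κ 𝔭 γ (PowerSeries.map (R1.unrToCpInt p) L) :=
  ⟨R1.imcEqIntAt_map, R1.imcEqOnTreeAt_of_imcEqIntAt_map⟩

end Pointwise

/-! ### §2 H3∀′ ⟺ H3∃⁻ ⟺ H3∃♭⁻ on semistable pairs (given A206) -/

section ClassLevel

variable {W : WeierstrassCurve ℚ} [W.IsElliptic] [W.IsGloballyMinimal] {p : ℕ} [Fact p.Prime]

/-- **H3∃♭⁻ ⟹ H3∀′ — NO fact, NO semistability.** If at every datum (read through an infinite place)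
SOME ♭-frame `(Ω_K₀ ≠ 0, ‖Ω_p₀‖ = 1, Q)` of `f_{Dt}` satisfies H3♭ (`R1.IMCEqIntCoreFrameOnTree`), then
H3 holds at EVERY `R₀`-frame `(Ω_K ≠ 0, Ω_p ∈ R₀ˣ, L)` of every datum and newform
(`R1.IMCEqAllFramesOnTree`): `f = f_{Dt}` (`IsNewformOf.unique`); re-read the datum through `w₀` at
`τ_* P` (`R1.exists_involution_map_eq`); ♭-IDEAL RIGIDITY (`R1.imcEqIntAt_forall_of_exists`: odd `p`,
`K` imaginary quadratic, `κ` anticyclotomic, periods non-zero) carries H3♭ from `Q` to `L` read in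
`𝓞_{ℂ_p}⟦T⟧` (`R1.isBDPLFunctionInt_map`); the receptacle descent (§1) gives H3 for `L`.
CONDITIONAL on H3∃♭⁻ (open). [cite: Castella2018Erratum, Thm. 1.1 (p. 1)]
[cite: Castella2018, Thm. 3.1 (arXiv:1704.06608 p. 9)] -/
theorem R1.imcEqAllFramesOnTree_of_imcEqIntCoreFrame (h3 : R1.IMCEqIntCoreFrameOnTree W p) :
    R1.IMCEqAllFramesOnTree W p := by
  intro _ q _ K _ _ Dt H ιK P hE hr hqp hmq hns hvq hK hCas hP hc hinf f hfW κ hκ γ _ ι' w₀ ΩK Ωp L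
    hΩ hL
  obtain rfl : f = Dt.f := hfW.unique Dt.isNewformOf
  have hp2 : p ≠ 2 := hE.two_ne
  obtain ⟨τ, hτ, hP', hinf'⟩ := R1.exists_involution_map_eq hK ιK w₀ Dt H hP hinf
  have hemb := mem_asIdeal_iff_norm_embAt_lt_one (primeOfEmbeddingDatum p ι' w₀.embedding)
    (natCast_mem_primeOfEmbeddingDatum p ι' w₀.embedding)
    (degreeOne_primeOfEmbeddingDatum_of_isErratumField hK (dvd_conductorNorm_of_mult hE.2.1) hqp ι'
      w₀.embedding).1
    (degreeOne_primeOfEmbeddingDatum_of_isErratumField hK (dvd_conductorNorm_of_mult hE.2.1) hqp ι'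
      w₀.embedding).2
  obtain ⟨ΩK₀, Ωp₀, Q, hΩ₀, hΩp₀1, hQ, h3Q⟩ :=
    h3 q K Dt H w₀ _ hE hr hqp hmq hns hvq hK hCas hP' hc hinf' κ hκ γ ι' _ hemb
  have hΩp₀ : Ωp₀ ≠ 0 := by
    intro h0
    rw [h0, norm_zero] at hΩp₀1
    exact zero_ne_one hΩp₀1
  have hΩp : ((Ωp : unrIntegers p) : ℂ_[p]) ≠ 0 := by
    rw [Ne, ZeroMemClass.coe_eq_zero]
    exact Units.ne_zero Ωp
  exact R1.imcEqOnTreeAt_of_imcEqIntAt_map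
    (R1.imcEqIntAt_forall_of_exists hp2 hK.1 hκ ⟨ΩK₀, Ωp₀, Q, hΩ₀, hΩp₀, hQ, h3Q⟩ hΩ hΩp
      (R1.isBDPLFunctionInt_map hL))

/-- **H3∃♭⁻ ⟹ H3∃⁻ on a SEMISTABLE pair, given A206** (an `R₀`-frame EXISTS:
`exists_isBDPLFunction_of_erratumHypotheses`; through H3∀′). CONDITIONAL on A206 (published) and
H3∃♭⁻ (open). [cite: Castella2018, Thm. 3.1 (arXiv:1704.06608 p. 9)] [cite: Castella2018Erratum, Thm. 1.1 (p. 1)] -/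
theorem R1.imcEqCoreFrameOnTree_of_imcEqIntCoreFrame_of_bdpExists
    (hBDP : castella2018_exists_isBDPLFunction) (hss : Semistable W)
    (h3 : R1.IMCEqIntCoreFrameOnTree W p) : R1.IMCEqCoreFrameOnTree W p :=
  R1.imcEqCoreFrameOnTree_of_imcEqAllFrames_of_bdpExists hBDP hss
    (R1.imcEqAllFramesOnTree_of_imcEqIntCoreFrame h3)

/-- **H3∃⁻ ⟺ H3∃♭⁻ on SEMISTABLE pairs, given A206**: route R1's ∃-core shape over `R₀⟦T⟧` (gen 25)
and its `R₀`-free ♭ twin over `𝓞_{ℂ_p}⟦T⟧` are EQUIVALENT (gen 25 had only `⟹`,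
`R1.imcEqIntCoreFrameOnTree_of_imcEqCoreFrame`). CONDITIONAL on A206 (published).
[cite: Castella2018, Thm. 3.1 (arXiv:1704.06608 p. 9)] [cite: Castella2018Erratum, Thm. 1.1 (p. 1)] -/
theorem R1.imcEqCoreFrameOnTree_iff_imcEqIntCoreFrame (hBDP : castella2018_exists_isBDPLFunction)
    (hss : Semistable W) : R1.IMCEqCoreFrameOnTree W p ↔ R1.IMCEqIntCoreFrameOnTree W p :=
  ⟨R1.imcEqIntCoreFrameOnTree_of_imcEqCoreFrame,
    R1.imcEqCoreFrameOnTree_of_imcEqIntCoreFrame_of_bdpExists hBDP hss⟩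

/-- **H3∀′ ⟺ H3∃♭⁻ on SEMISTABLE pairs, given A206**: the corrected ∀-frame half over `R₀⟦T⟧` and the
∃♭-core shape over `𝓞_{ℂ_p}⟦T⟧` are EQUIVALENT — with `R1.imcEqAllFramesOnTree_iff_imcEqCoreFrame`
the three currencies H3∀′, H3∃⁻, H3∃♭⁻ agree: route R1's main-conjecture half is ONE statement per
datum, independent of the frame and of the receptacle. CONDITIONAL on A206 (published).
[cite: Castella2018, Thm. 3.1 (arXiv:1704.06608 p. 9)] [cite: Castella2018Erratum, Thm. 1.1 (p. 1)] -/
theorem R1.imcEqAllFramesOnTree_iff_imcEqIntCoreFrame (hBDP : castella2018_exists_isBDPLFunction)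
    (hss : Semistable W) : R1.IMCEqAllFramesOnTree W p ↔ R1.IMCEqIntCoreFrameOnTree W p :=
  ⟨fun h3 ↦ R1.imcEqIntCoreFrameOnTree_of_imcEqCoreFrame
      (R1.imcEqCoreFrameOnTree_of_imcEqAllFrames_of_bdpExists hBDP hss h3),
    R1.imcEqAllFramesOnTree_of_imcEqIntCoreFrame⟩

end ClassLevel

end Summit.BirchSwinnertonDyer.Rank1Residual.X11b

end
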